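import Summits.QuantumFields.YangMills.Theorems.BalabanUVNodesN09CentralWindowInjective
import Literature.MathematicalPhysics.QuantumFieldTheory.Balaban1983to89.BlockAveragingEMLLinearisedBackground
import Literature.MathematicalPhysics.QuantumFieldTheory.Balaban1983to89.B10StarCount
import HarnessLib

/-!
# S2β · (CURL-AVG, FILE A) LINEARISED NON-ABELIAN LATTICE STOKES FOR THE COVARIANT WALK SUM `Y_{U₀}(Γ)`: backtracks are free, an adjacent transposition costs the
# transported linearised plaquette plus a `2δ`-small conjugation defect, and hence `‖Y_{U₀}(∂R_{a×b}(x))‖ ≤ Σ_{plaquettes q of R} ‖Y_{U₀}(∂q)‖ + a·b·2δ·(a + 2b + 2)·max‖Y‖`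

Cell `ym3-torus` (YM ladder rung R3 = continuum `SU(2)` Yang–Mills on the three-torus at fixed lattice data — a RUNG: NOT d = 4, NOT infinite volume, NOT a mass gap,
NOT Clay).  Width seat `ym3-torus-px13` (gen 26); crux `stmt-QuantumFields-20520`, LINE g18-1 S2β, pairing lane, AVG₂♭-ax_q ∕ `hLoc` ⟸ SUP chain ⟸ (ST) ⟸ (SCT) + lift recursion
(px17 g22 UV3-NODE §94.5); the per-step brick of (SCT) is (CURL-AVG) «the one-step (0.4) average transports covariant curls by DILUTED Stokes» (px16 g22 lane GO 16:56:35Z).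
THIS FILE is its lattice-kinematic half: the FIRST-ORDER (linearised) Stokes calculus for the lit covariant walk sum `covWalkSum U₀ Y` of
`BlockAveragingEMLLinearisedBackground` ([Balaban1985Averaging] (58): every bond term transported back to the start of the walk), at a background `U₀` whose plaquette
variables are within `δ` of `1` (`PlaqSmall δ U₀`) — the linear shadow of lit `LatticeWordStokes` (which does the same for `dist1` of holonomies).  `--kind proof
--supports stmt-QuantumFields-20520 --as helper`, count-neutral, DEFINITION-FREE; generic `P : Params`, `SU(N)`, level `j`, matrix-valued bond fields `Y`.

NOTATION (written out).  `S_x(w) := covWalkSum U₀ Y (walk x w)`; `H_x(w) := ↑(holAt U₀ (walk x w))`; the LINEARISED PLAQUETTE WORD-SUM at `y` for letters `m₁, m₂`: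
`Π_y(m₁,m₂) := S_y([m₁, m₂, m̄₁, m̄₂])` (for `m₁ = ν⁺`, `m₂ = μ̄` this is the boundary of the `(μ,ν)`-plaquette whose lower-RIGHT corner is `y`, read from `y`); the commutator
defect `D := holAt(walk y [m₁,m₂])·holAt(walk y [m₂,m₁])⁻¹` (a conjugated plaquette variable, lit `dist1_swapDefect_le`: `dist1 D ≤ δ`).

WHAT IS PROVED (sorry-free).
* §1 letters: `norm_coe_conj_le` (`‖gMg⋆‖ ≤ ‖M‖`), `norm_conj_sub_self_le` (`‖DTD⋆ − T‖ ≤ 2·dist1 D·‖T‖`) (+ two private site letters).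
* §2 calculus: `covWalkSum_walk_append`; ★`covWalkSum_walk_pair_flip` (`S_y([m, m̄]) = 0`), ★`covWalkSum_walk_backtrack` (`S_x(A m m̄ C) = S_x(A C)`), `covWalkSum_walk_replicate_backtrack`
  (`S_x(m^b m̄^b) = 0`); ★`covWalkSum_walk_square_pair` (`Π_y(m₁,m₂) = S_y[m₁,m₂] − D·S_y[m₂,m₁]·D⋆`); ★★`covWalkSum_walk_swap_eq` — THE EXACT SWAP IDENTITY
  **`S_x(A m₁ m₂ C) = S_x(A m₂ m₁ C) + H_A·Π_y(m₁,m₂)·H_A⋆ + H_A·(D·T·D⋆ − T)·H_A⋆`**, `y = x_A`, `T = S_y(m₂ m₁ C)`.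
* §3 ★`norm_covWalkSum_walk_swap_sub_le` — `‖S_x(A m₁ m₂ C) − S_x(A m₂ m₁ C)‖ ≤ ‖Π_y(m₁,m₂)‖ + 2δ·(|C| + 2)·M` (`‖Y b‖ ≤ M`).
* §4 ★`norm_covWalkSum_colPeel_le` — moving `μ̄` leftward through `t` letters `ν⁺` costs the `t` corner plaquettes plus `t·2δ·(t + r + |R| + 2)·M`.
* §5 ★★★`norm_covWalkSum_rect_le` — **`‖S_x(μ^a ν^b μ̄^a ν̄^b)‖ ≤ Σ_{s<a} Σ_{t<b} ‖Π_{walkEnd x (μ^{s+1} ν^t)}(ν⁺, μ̄)‖ + a·b·2δ·(a + 2b + 2)·M`** — each of the `ab` plaquettes of the rectangle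
  exactly ONCE (induction on `a`, peeling the last column; `S_x(ν^b ν̄^b) = 0`).  This is the inequality form of the linearised Stokes theorem with the explicit
  commutator-defect budget; summing it over the `L^d` block points is what makes the (0.4) average's coarse curl a DILUTED (`L^{2−d}`-weighted) sum of fine curls (FILE B).

HONEST.  Lattice kinematics ∕ matrix algebra over lit `covWalkSum`, `holAt_walk_backtrack`, `dist1_swapDefect_le`; nothing of Bałaban's analysis; the coarse-curl identity for
`Q₁^{R₀}` (FILE B), the nonlinear remainder (FILE C), (SCT), (ST), LOC ∕ `hLoc`, AVG₂♭-ax_q, GAP♯∘ (registry UNTOUCHED), the five REGISTERED stubs, S2β, crux 20520, 19936, 19200,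
`YM3TorusSU2` — NOT proved; rung R3 = SU(2) YM₃ on T³ at fixed lattice data — NOT d = 4, NOT infinite volume, NOT a mass gap, NOT Clay; the Yang–Mills mass gap is NOT proved.
Axioms standard.

References: [Balaban1985Averaging] CMP **98** (1985) (7)–(9) pp.18–19, (19)–(20) p.21, Prop. 1 (51) p.26, (56)–(58) p.27; [Balaban1987RG1] CMP **109** (1987) (0.4) p.253.
-/

set_option autoImplicit false

noncomputable section

open scoped Matrix.Norms.L2Operator BigOperators
open Finset

namespace Summit.QuantumFields.YangMills.Theorems.FluctuationComparisonRegPrIntLS2BetaCovWalkSumStokes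

open Literature.MathematicalPhysics.QuantumFieldTheory.Balaban1983to89
open Literature.MathematicalPhysics.QuantumFieldTheory.Balaban1983to89.T4Continuum
open Literature.MathematicalPhysics.QuantumFieldTheory.Balaban1983to89.BlockAveragingEMLLinearised (stepFactor length_walk)
open Literature.MathematicalPhysics.QuantumFieldTheory.Balaban1983to89.BlockAveragingEMLLinearisedBackground
  (covStep covWalkSum covWalkSum_nil covWalkSum_cons covWalkSum_append covWalkSum_walk_wordRev norm_covWalkSum_le)
open Literature.MathematicalPhysics.QuantumFieldTheory.Balaban1983to89.LatticeWordStokes (holAt_walk_backtrack dist1_swapDefect_le)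
open Literature.MathematicalPhysics.QuantumFieldTheory.Balaban1983to89.B10StarCount (shift_unshift unshift_shift)
open Literature.MathematicalPhysics.QuantumFieldTheory.Balaban1983to89.Node00
open Summit.QuantumFields.YangMills.BalabanUVNodes.N09CentralWindowInjective (norm_coe_SU_le_one)

variable {P : Params} {j : ℕ} {N : ℕ} [NeZero N]

/-! ## §1 Matrix letters: unitary conjugation is a contraction; a near-identity conjugation moves little -/

section Letters

/-- `‖g·M·g⋆‖ ≤ ‖M‖` for `g ∈ SU(N)`. [folklore] -/
theorem norm_coe_conj_le (g : SU N) (M : Matrix (Fin N) (Fin N) ℂ) :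
    ‖(g : Matrix (Fin N) (Fin N) ℂ) * M * star (g : Matrix (Fin N) (Fin N) ℂ)‖ ≤ ‖M‖ := by
  have h1 := norm_coe_SU_le_one g
  have h2 : ‖star (g : Matrix (Fin N) (Fin N) ℂ)‖ ≤ 1 := by rw [norm_star]; exact h1
  calc _ ≤ ‖(g : Matrix (Fin N) (Fin N) ℂ) * M‖ * ‖star (g : Matrix (Fin N) (Fin N) ℂ)‖ := norm_mul_le _ _
    _ ≤ ‖(g : Matrix (Fin N) (Fin N) ℂ)‖ * ‖M‖ * 1 := mul_le_mul (norm_mul_le _ _) h2 (norm_nonneg _) (by positivity)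
    _ ≤ 1 * ‖M‖ * 1 := by gcongr
    _ = ‖M‖ := by ring

/-- `‖D·T·D⋆ − T‖ ≤ 2·dist1(D)·‖T‖` (`dist1 D = ‖↑D − 1‖`). [cite: Balaban1985Averaging, (19)-(20) p.21 (bookkeeping)] -/
theorem norm_conj_sub_self_le (D : SU N) (T : Matrix (Fin N) (Fin N) ℂ) :
    ‖(D : Matrix (Fin N) (Fin N) ℂ) * T * star (D : Matrix (Fin N) (Fin N) ℂ) - T‖ ≤ 2 * dist1 D * ‖T‖ := by
  have hsplit : (D : Matrix (Fin N) (Fin N) ℂ) * T * star (D : Matrix (Fin N) (Fin N) ℂ) - T =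
      ((D : Matrix (Fin N) (Fin N) ℂ) - 1) * T * star (D : Matrix (Fin N) (Fin N) ℂ) + T * (star (D : Matrix (Fin N) (Fin N) ℂ) - 1) := by
    noncomm_ring
  have hd : ‖(D : Matrix (Fin N) (Fin N) ℂ) - 1‖ = dist1 D := rfl
  have hds : ‖star (D : Matrix (Fin N) (Fin N) ℂ) - 1‖ = dist1 D := by
    rw [← hd, ← norm_star, star_sub, star_star, star_one]
  have hs : ‖star (D : Matrix (Fin N) (Fin N) ℂ)‖ ≤ 1 := by rw [norm_star]; exact norm_coe_SU_le_one D
  rw [hsplit]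
  calc _ ≤ ‖((D : Matrix (Fin N) (Fin N) ℂ) - 1) * T * star (D : Matrix (Fin N) (Fin N) ℂ)‖ + ‖T * (star (D : Matrix (Fin N) (Fin N) ℂ) - 1)‖ := norm_add_le _ _
    _ ≤ ‖(D : Matrix (Fin N) (Fin N) ℂ) - 1‖ * ‖T‖ * ‖star (D : Matrix (Fin N) (Fin N) ℂ)‖ + ‖T‖ * ‖star (D : Matrix (Fin N) (Fin N) ℂ) - 1‖ :=
        add_le_add ((norm_mul_le _ _).trans (mul_le_mul_of_nonneg_right (norm_mul_le _ _) (norm_nonneg _))) (norm_mul_le _ _)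
    _ ≤ dist1 D * ‖T‖ * 1 + ‖T‖ * dist1 D := by
        rw [hd, hds]
        have hD0 : 0 ≤ dist1 D := GaugeGroup.dist1_nonneg D
        exact add_le_add (mul_le_mul_of_nonneg_left hs (mul_nonneg hD0 (norm_nonneg _))) le_rfl
    _ = 2 * dist1 D * ‖T‖ := by ring

/-- The walks `[m₁, m₂]` and `[m₂, m₁]` end at the same site (private copy of ✓`B13AvgCorrStokes.walkEnd_pair_comm`, whose module is outside this cone). [folklore] -/
private theorem walkEnd_pair_comm' (y : Site P j) (m₁ m₂ : Letter P.d) : walkEnd y [m₁, m₂] = walkEnd y [m₂, m₁] := by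
  funext ν
  rw [walkEnd_apply, walkEnd_apply, netDisp_cons, netDisp_cons, netDisp_cons, netDisp_cons]
  push_cast
  ring

/-- A backtrack `[m, m̄]` returns to its base (private copy of ✓`BoxStokes.walkEnd_pair_flip`, whose module is outside this cone). [folklore] -/
private theorem walkEnd_pair_flip (y : Site P j) (m : Letter P.d) : walkEnd y [m, m.flip] = y := by
  obtain ⟨a, s⟩ := m
  cases s
  · show (y.unshift a).shift a = y
    exact shift_unshift y a
  · show (y.shift a).unshift a = y
    exact unshift_shift y a

end Letters

/-! ## §2 The covariant walk sum along concatenations, backtracks and reversed pairs -/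

section Calculus

variable (U₀ : GaugeField P j (SU N)) (Y : PBond P j → Matrix (Fin N) (Fin N) ℂ)

/-- **CONCATENATION OF WORDS**: `Y_{U₀}(walk x (w₁w₂)) = Y_{U₀}(walk x w₁) + U₀(w₁)·Y_{U₀}(walk x_{w₁} w₂)·U₀(w₁)⋆`. [cite: Balaban1985Averaging, (58) p.27] -/
theorem covWalkSum_walk_append (x : Site P j) (w₁ w₂ : List (Letter P.d)) :
    covWalkSum U₀ Y (walk x (w₁ ++ w₂)) =
      covWalkSum U₀ Y (walk x w₁) + ((holAt U₀ (walk x w₁) : SU N) : Matrix (Fin N) (Fin N) ℂ) * covWalkSum U₀ Y (walk (walkEnd x w₁) w₂) *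
        star ((holAt U₀ (walk x w₁) : SU N) : Matrix (Fin N) (Fin N) ℂ) := by
  rw [walk_append, covWalkSum_append]

omit [NeZero N] in
/-- **A BACKTRACK CONTRIBUTES NOTHING**: `Y_{U₀}(walk y [m, m̄]) = 0` (the bond variable enters twice with opposite transported signs). [cite: Balaban1985Averaging, (7) p.18, (58) p.27] -/
theorem covWalkSum_walk_pair_flip (y : Site P j) (m : Letter P.d) : covWalkSum U₀ Y (walk y [m, m.flip]) = 0 := by
  obtain ⟨a, s⟩ := m
  cases s
  · -- backward then forward on the bond `⟨y − e_a, a⟩`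
    have hw : walk y [((a, false) : Letter P.d), Letter.flip (a, false)] =
        [⟨⟨y.unshift a, a⟩, false⟩, ⟨⟨y.unshift a, a⟩, true⟩] := by
      simp [walk, Letter.flip]
    rw [hw, covWalkSum_cons, covWalkSum_cons, covWalkSum_nil]
    simp only [covStep, stepFactor, Bool.false_eq_true, ↓reduceIte, mul_zero, zero_mul, add_zero, star_star]
    rw [neg_add_eq_sub, sub_eq_zero]
  · -- forward then backward on the bond `⟨y, a⟩`
    have hw : walk y [((a, true) : Letter P.d), Letter.flip (a, true)] =
        [⟨⟨y, a⟩, true⟩, ⟨⟨y, a⟩, false⟩] := by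
      simp [walk, Letter.flip]
    rw [hw, covWalkSum_cons, covWalkSum_cons, covWalkSum_nil]
    simp only [covStep, stepFactor, Bool.false_eq_true, ↓reduceIte, mul_zero, zero_mul, add_zero, star_star]
    set u : Matrix (Fin N) (Fin N) ℂ := ((U₀ ⟨y, a⟩ : SU N) : Matrix (Fin N) (Fin N) ℂ) with hu
    have h1 : u * star u = 1 := coe_mul_star_coe_SU _
    calc Y ⟨y, a⟩ + u * -(star u * Y ⟨y, a⟩ * u) * star u = Y ⟨y, a⟩ - (u * star u) * Y ⟨y, a⟩ * (u * star u) := by noncomm_ring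
      _ = 0 := by rw [h1, one_mul, mul_one, sub_self]

/-- **BACKTRACKS ARE FREE FOR THE WALK SUM**: `Y_{U₀}(walk x (A m m̄ C)) = Y_{U₀}(walk x (A C))`. [cite: Balaban1985Averaging, (7) p.18, (58) p.27] -/
theorem covWalkSum_walk_backtrack (x : Site P j) (A C : List (Letter P.d)) (m : Letter P.d) :
    covWalkSum U₀ Y (walk x (A ++ m :: m.flip :: C)) = covWalkSum U₀ Y (walk x (A ++ C)) := by
  have h₁ : A ++ m :: m.flip :: C = (A ++ [m, m.flip]) ++ C := by simp
  rw [h₁, covWalkSum_walk_append, covWalkSum_walk_append U₀ Y x A C]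
  have hhol : holAt U₀ (walk x (A ++ [m, m.flip])) = holAt U₀ (walk x A) := by
    have h := holAt_walk_backtrack U₀ x A [] m
    simpa using h
  have hend : walkEnd x (A ++ [m, m.flip]) = walkEnd x A := by rw [walkEnd_append, walkEnd_pair_flip]
  have hsum : covWalkSum U₀ Y (walk x (A ++ [m, m.flip])) = covWalkSum U₀ Y (walk x A) := by
    rw [covWalkSum_walk_append, covWalkSum_walk_pair_flip, mul_zero, zero_mul, add_zero]
  rw [hhol, hend, hsum]

/-- `Y_{U₀}(walk x (ν^b ν̄^b)) = 0` (a pure backtrack ladder). [cite: Balaban1985Averaging, (7) p.18 (bookkeeping)] -/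
theorem covWalkSum_walk_replicate_backtrack (x : Site P j) (m : Letter P.d) :
    ∀ b : ℕ, covWalkSum U₀ Y (walk x (List.replicate b m ++ List.replicate b m.flip)) = 0
  | 0 => by simp [walk]
  | b + 1 => by
    have h : List.replicate (b + 1) m ++ List.replicate (b + 1) m.flip = List.replicate b m ++ m :: m.flip :: List.replicate b m.flip := by
      rw [List.replicate_succ', List.append_assoc, List.singleton_append, List.replicate_succ]
    rw [h, covWalkSum_walk_backtrack, covWalkSum_walk_replicate_backtrack x m b]

/-- **THE LINEARISED PLAQUETTE AS «PAIR MINUS TRANSPORTED SWAPPED PAIR»**: with `D = U₀(m₁m₂)·U₀(m₂m₁)⁻¹` the commutator defect at `y`,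
`Y_{U₀}(walk y [m₁, m₂, m̄₁, m̄₂]) = Y_{U₀}(walk y [m₁, m₂]) − D·Y_{U₀}(walk y [m₂, m₁])·D⋆`. [cite: Balaban1985Averaging, (58) p.27, (19) p.21] -/
theorem covWalkSum_walk_square_pair (y : Site P j) (m₁ m₂ : Letter P.d) :
    covWalkSum U₀ Y (walk y [m₁, m₂, m₁.flip, m₂.flip]) =
      covWalkSum U₀ Y (walk y [m₁, m₂]) -
        ((holAt U₀ (walk y [m₁, m₂]) * (holAt U₀ (walk y [m₂, m₁]))⁻¹ : SU N) : Matrix (Fin N) (Fin N) ℂ) *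
          covWalkSum U₀ Y (walk y [m₂, m₁]) *
        star ((holAt U₀ (walk y [m₁, m₂]) * (holAt U₀ (walk y [m₂, m₁]))⁻¹ : SU N) : Matrix (Fin N) (Fin N) ℂ) := by
  have h₁ : [m₁, m₂, m₁.flip, m₂.flip] = [m₁, m₂] ++ wordRev [m₂, m₁] := by simp [wordRev]
  rw [h₁, covWalkSum_walk_append, walkEnd_pair_comm' y m₁ m₂, covWalkSum_walk_wordRev U₀ Y y [m₂, m₁]]
  rw [Submonoid.coe_mul, coe_inv_SU, star_mul, star_star]
  noncomm_ring

/-- **THE SWAP IDENTITY FOR THE WALK SUM**: transposing two adjacent letters costs the transported linearised plaquette at the corner plus a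
commutator-defect conjugation of the tail: `Y_{U₀}(A m₁ m₂ C) = Y_{U₀}(A m₂ m₁ C) + U₀(A)·Π_y(m₁,m₂)·U₀(A)⋆ + U₀(A)·(D·T·D⋆ − T)·U₀(A)⋆`,
`y = x_A`, `Π_y(m₁,m₂) = Y_{U₀}(walk y [m₁,m₂,m̄₁,m̄₂])`, `T = Y_{U₀}(walk y (m₂ m₁ C))`. [cite: Balaban1985Averaging, (9) p.19, (58) p.27] -/
theorem covWalkSum_walk_swap_eq (x : Site P j) (A C : List (Letter P.d)) (m₁ m₂ : Letter P.d) :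
    covWalkSum U₀ Y (walk x (A ++ m₁ :: m₂ :: C)) =
      covWalkSum U₀ Y (walk x (A ++ m₂ :: m₁ :: C)) +
        ((holAt U₀ (walk x A) : SU N) : Matrix (Fin N) (Fin N) ℂ) * covWalkSum U₀ Y (walk (walkEnd x A) [m₁, m₂, m₁.flip, m₂.flip]) * star ((holAt U₀ (walk x A) : SU N) : Matrix (Fin N) (Fin N) ℂ) +
        ((holAt U₀ (walk x A) : SU N) : Matrix (Fin N) (Fin N) ℂ) * (((holAt U₀ (walk (walkEnd x A) [m₁, m₂]) * (holAt U₀ (walk (walkEnd x A) [m₂, m₁]))⁻¹ : SU N) : Matrix (Fin N) (Fin N) ℂ) * covWalkSum U₀ Y (walk (walkEnd x A) (m₂ :: m₁ :: C)) * star ((holAt U₀ (walk (walkEnd x A) [m₁, m₂]) * (holAt U₀ (walk (walkEnd x A) [m₂, m₁]))⁻¹ : SU N) : Matrix (Fin N) (Fin N) ℂ) - covWalkSum U₀ Y (walk (walkEnd x A) (m₂ :: m₁ :: C))) * star ((holAt U₀ (walk x A) : SU N) : Matrix (Fin N) (Fin N) ℂ) := by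
  set y := walkEnd x A with hy
  have e₁ : A ++ m₁ :: m₂ :: C = A ++ ([m₁, m₂] ++ C) := by simp
  have e₂ : A ++ m₂ :: m₁ :: C = A ++ ([m₂, m₁] ++ C) := by simp
  have e₃ : (m₂ :: m₁ :: C) = [m₂, m₁] ++ C := by simp
  rw [e₁, e₂, covWalkSum_walk_append, covWalkSum_walk_append U₀ Y x A, e₃, covWalkSum_walk_append U₀ Y y [m₁, m₂] C,
    covWalkSum_walk_append U₀ Y y [m₂, m₁] C, covWalkSum_walk_square_pair, walkEnd_pair_comm' y m₁ m₂]
  -- abbreviations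
  set H : Matrix (Fin N) (Fin N) ℂ := ((holAt U₀ (walk x A) : SU N) : Matrix (Fin N) (Fin N) ℂ)
  set H₁₂ : Matrix (Fin N) (Fin N) ℂ := ((holAt U₀ (walk y [m₁, m₂]) : SU N) : Matrix (Fin N) (Fin N) ℂ)
  set H₂₁ : Matrix (Fin N) (Fin N) ℂ := ((holAt U₀ (walk y [m₂, m₁]) : SU N) : Matrix (Fin N) (Fin N) ℂ)
  set S₁₂ := covWalkSum U₀ Y (walk y [m₁, m₂])
  set S₂₁ := covWalkSum U₀ Y (walk y [m₂, m₁])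
  set SC := covWalkSum U₀ Y (walk (walkEnd y [m₂, m₁]) C)
  have hD : (((holAt U₀ (walk y [m₁, m₂]) * (holAt U₀ (walk y [m₂, m₁]))⁻¹ : SU N)) : Matrix (Fin N) (Fin N) ℂ) = H₁₂ * star H₂₁ := by
    rw [Submonoid.coe_mul, coe_inv_SU]
  rw [hD, star_mul, star_star]
  have h21 : star H₂₁ * H₂₁ = 1 := star_coe_mul_coe_SU _
  -- `D·(S₂₁ + H₂₁ SC H₂₁⋆)·D⋆ = D S₂₁ D⋆ + H₁₂ SC H₁₂⋆` since `D H₂₁ = H₁₂`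
  have key : H₁₂ * star H₂₁ * (S₂₁ + H₂₁ * SC * star H₂₁) * (H₂₁ * star H₁₂) =
      H₁₂ * star H₂₁ * S₂₁ * (H₂₁ * star H₁₂) + H₁₂ * (star H₂₁ * H₂₁) * SC * (star H₂₁ * H₂₁) * star H₁₂ := by noncomm_ring
  rw [h21] at key
  simp only [mul_one] at key
  calc covWalkSum U₀ Y (walk x A) + H * (S₁₂ + H₁₂ * SC * star H₁₂) * star H
      = covWalkSum U₀ Y (walk x A) + H * (S₂₁ + H₂₁ * SC * star H₂₁) * star H + H * (S₁₂ - H₁₂ * star H₂₁ * S₂₁ * (H₂₁ * star H₁₂)) * star H +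
          H * (H₁₂ * star H₂₁ * (S₂₁ + H₂₁ * SC * star H₂₁) * (H₂₁ * star H₁₂) - (S₂₁ + H₂₁ * SC * star H₂₁)) * star H := by
        rw [key]; noncomm_ring
    _ = _ := by rfl

end Calculus

/-! ## §3 The cost of one transposition: the linearised plaquette plus `2δ·(|C|+2)·max‖Y‖` -/

section Bounds

variable (U₀ : GaugeField P j (SU N)) (Y : PBond P j → Matrix (Fin N) (Fin N) ℂ)

/-- ★ **ONE ADJACENT TRANSPOSITION COSTS ONE LINEARISED PLAQUETTE**: if every plaquette variable of the background is within `δ` of `1` and `‖Y b‖ ≤ M` for all `b`, then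
`‖Y_{U₀}(A m₁ m₂ C) − Y_{U₀}(A m₂ m₁ C)‖ ≤ ‖Y_{U₀}(walk x_A [m₁,m₂,m̄₁,m̄₂])‖ + 2δ·(|C| + 2)·M` (the swap identity; unitary conjugations contract the norm; the commutator
defect `D` is within `δ` of `1`, lit ✓`LatticeWordStokes.dist1_swapDefect_le`). [cite: Balaban1985Averaging, (19)-(20) p.21, (58) p.27] -/
theorem norm_covWalkSum_walk_swap_sub_le {δ M : ℝ} (hδ : 0 ≤ δ) (hU : PlaqSmall δ U₀) (hY : ∀ b, ‖Y b‖ ≤ M)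
    (x : Site P j) (A C : List (Letter P.d)) (m₁ m₂ : Letter P.d) :
    ‖covWalkSum U₀ Y (walk x (A ++ m₁ :: m₂ :: C)) - covWalkSum U₀ Y (walk x (A ++ m₂ :: m₁ :: C))‖ ≤
      ‖covWalkSum U₀ Y (walk (walkEnd x A) [m₁, m₂, m₁.flip, m₂.flip])‖ + 2 * δ * ((C.length : ℝ) + 2) * M := by
  rw [covWalkSum_walk_swap_eq U₀ Y x A C m₁ m₂]
  set y := walkEnd x A with hy
  set H : SU N := holAt U₀ (walk x A) with hH
  set D : SU N := holAt U₀ (walk y [m₁, m₂]) * (holAt U₀ (walk y [m₂, m₁]))⁻¹ with hD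
  set T : Matrix (Fin N) (Fin N) ℂ := covWalkSum U₀ Y (walk y (m₂ :: m₁ :: C)) with hT
  set Pl : Matrix (Fin N) (Fin N) ℂ := covWalkSum U₀ Y (walk y [m₁, m₂, m₁.flip, m₂.flip]) with hPl
  have hM0 : 0 ≤ M := (norm_nonneg _).trans (hY ⟨x, m₁.1⟩)
  have hDδ : dist1 D ≤ δ := dist1_swapDefect_le U₀ hδ hU y m₁ m₂
  have hTn : ‖T‖ ≤ ((C.length : ℝ) + 2) * M := by
    have h := norm_covWalkSum_le U₀ hY (walk y (m₂ :: m₁ :: C))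
    rw [length_walk] at h
    simpa [List.length_cons, add_assoc, one_add_one_eq_two] using h
  have e : covWalkSum U₀ Y (walk x (A ++ m₂ :: m₁ :: C)) + (H : Matrix (Fin N) (Fin N) ℂ) * Pl * star (H : Matrix (Fin N) (Fin N) ℂ) +
      (H : Matrix (Fin N) (Fin N) ℂ) * ((D : Matrix (Fin N) (Fin N) ℂ) * T * star (D : Matrix (Fin N) (Fin N) ℂ) - T) * star (H : Matrix (Fin N) (Fin N) ℂ) - covWalkSum U₀ Y (walk x (A ++ m₂ :: m₁ :: C)) =
      (H : Matrix (Fin N) (Fin N) ℂ) * Pl * star (H : Matrix (Fin N) (Fin N) ℂ) + (H : Matrix (Fin N) (Fin N) ℂ) * ((D : Matrix (Fin N) (Fin N) ℂ) * T * star (D : Matrix (Fin N) (Fin N) ℂ) - T) * star (H : Matrix (Fin N) (Fin N) ℂ) := by abel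
  rw [e]
  calc _ ≤ ‖(H : Matrix (Fin N) (Fin N) ℂ) * Pl * star (H : Matrix (Fin N) (Fin N) ℂ)‖ + ‖(H : Matrix (Fin N) (Fin N) ℂ) * ((D : Matrix (Fin N) (Fin N) ℂ) * T * star (D : Matrix (Fin N) (Fin N) ℂ) - T) * star (H : Matrix (Fin N) (Fin N) ℂ)‖ := norm_add_le _ _
    _ ≤ ‖Pl‖ + ‖(D : Matrix (Fin N) (Fin N) ℂ) * T * star (D : Matrix (Fin N) (Fin N) ℂ) - T‖ := add_le_add (norm_coe_conj_le H Pl) (norm_coe_conj_le H _)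
    _ ≤ ‖Pl‖ + 2 * dist1 D * ‖T‖ := add_le_add le_rfl (norm_conj_sub_self_le D T)
    _ ≤ ‖Pl‖ + 2 * δ * (((C.length : ℝ) + 2) * M) := by
        have hD0 : 0 ≤ dist1 D := GaugeGroup.dist1_nonneg D
        nlinarith [norm_nonneg T, mul_le_mul hDδ hTn (norm_nonneg T) hδ]
    _ = ‖Pl‖ + 2 * δ * ((C.length : ℝ) + 2) * M := by ring

/-! ## §4 Peeling one column: moving the first `μ̄` leftward through the `ν`-run -/

/-- **COLUMN PEEL**: moving `μ̄` leftward through `t` letters `ν⁺` (from position `rep (a+1) μ⁺ ++ rep t ν⁺`) costs the `t` linearised plaquettes at the corners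
`y_s = x + (a+1)e_μ + s·e_ν` plus `t·2δ·(t + r + |R| + 2)·M` (any tail `rep r ν⁺ ++ R`). [cite: Balaban1985Averaging, (19)-(20) p.21, (58) p.27] -/
theorem norm_covWalkSum_colPeel_le {δ M : ℝ} (hδ : 0 ≤ δ) (hU : PlaqSmall δ U₀) (hY : ∀ b, ‖Y b‖ ≤ M)
    (x : Site P j) (μ ν : Fin P.d) (a : ℕ) (R : List (Letter P.d)) :
    ∀ (t r : ℕ), ‖covWalkSum U₀ Y (walk x (List.replicate (a + 1) (μ, true) ++ List.replicate t (ν, true) ++ (μ, false) :: (List.replicate r (ν, true) ++ R))) -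
        covWalkSum U₀ Y (walk x (List.replicate (a + 1) (μ, true) ++ (μ, false) :: (List.replicate (t + r) (ν, true) ++ R)))‖ ≤
      (∑ s ∈ Finset.range t, ‖covWalkSum U₀ Y (walk (walkEnd x (List.replicate (a + 1) (μ, true) ++ List.replicate s (ν, true)))
          [((ν, true) : Letter P.d), (μ, false), (ν, false), (μ, true)])‖) +
        (t : ℝ) * (2 * δ * ((t : ℝ) + r + R.length + 2) * M)
  | 0, r => by simp
  | t + 1, r => by
    have hM0 : 0 ≤ M := (norm_nonneg _).trans (hY ⟨x, μ⟩)
    -- the word with `t+1` letters `ν⁺` before `μ̄` is one transposition away from the word with `t` letters before and `r+1` after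
    have ht : List.replicate (t + 1) ((ν, true) : Letter P.d) = List.replicate t (ν, true) ++ [(ν, true)] := List.replicate_succ'
    have hr : List.replicate (r + 1) ((ν, true) : Letter P.d) = (ν, true) :: List.replicate r (ν, true) := List.replicate_succ
    have e₁ : List.replicate (a + 1) ((μ, true) : Letter P.d) ++ List.replicate (t + 1) (ν, true) ++ (μ, false) :: (List.replicate r (ν, true) ++ R) =
        (List.replicate (a + 1) (μ, true) ++ List.replicate t (ν, true)) ++ (ν, true) :: (μ, false) :: (List.replicate r (ν, true) ++ R) := by
      rw [ht]; simp only [List.append_assoc, List.cons_append, List.nil_append]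
    have e₂ : (List.replicate (a + 1) ((μ, true) : Letter P.d) ++ List.replicate t (ν, true)) ++ (μ, false) :: (ν, true) :: (List.replicate r (ν, true) ++ R) =
        List.replicate (a + 1) (μ, true) ++ List.replicate t (ν, true) ++ (μ, false) :: (List.replicate (r + 1) (ν, true) ++ R) := by
      rw [hr]; simp only [List.append_assoc, List.cons_append]
    have hswap := norm_covWalkSum_walk_swap_sub_le U₀ Y hδ hU hY x (List.replicate (a + 1) (μ, true) ++ List.replicate t (ν, true))
      (List.replicate r (ν, true) ++ R) (ν, true) (μ, false)
    rw [← e₁, e₂] at hswap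
    have ih := norm_covWalkSum_colPeel_le hδ hU hY x μ ν a R t (r + 1)
    have hflip1 : Letter.flip ((ν, true) : Letter P.d) = (ν, false) := rfl
    have hflip2 : Letter.flip ((μ, false) : Letter P.d) = (μ, true) := rfl
    rw [hflip1, hflip2] at hswap
    have hlen : ((List.replicate r ((ν, true) : Letter P.d) ++ R).length : ℝ) = r + R.length := by
      rw [List.length_append, List.length_replicate]; push_cast; ring
    rw [hlen] at hswap
    have htr : (t : ℕ) + (r + 1) = t + 1 + r := by omega
    rw [htr] at ih
    rw [Finset.sum_range_succ]
    calc _ ≤ ‖covWalkSum U₀ Y (walk x (List.replicate (a + 1) (μ, true) ++ List.replicate (t + 1) (ν, true) ++ (μ, false) :: (List.replicate r (ν, true) ++ R))) -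
            covWalkSum U₀ Y (walk x (List.replicate (a + 1) (μ, true) ++ List.replicate t (ν, true) ++ (μ, false) :: (List.replicate (r + 1) (ν, true) ++ R)))‖ +
          ‖covWalkSum U₀ Y (walk x (List.replicate (a + 1) (μ, true) ++ List.replicate t (ν, true) ++ (μ, false) :: (List.replicate (r + 1) (ν, true) ++ R))) -
            covWalkSum U₀ Y (walk x (List.replicate (a + 1) (μ, true) ++ (μ, false) :: (List.replicate (t + 1 + r) (ν, true) ++ R)))‖ := norm_sub_le_norm_sub_add_norm_sub _ _ _
      _ ≤ (‖covWalkSum U₀ Y (walk (walkEnd x (List.replicate (a + 1) (μ, true) ++ List.replicate t (ν, true))) [((ν, true) : Letter P.d), (μ, false), (ν, false), (μ, true)])‖ +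
            2 * δ * ((r : ℝ) + R.length + 2) * M) +
          ((∑ s ∈ Finset.range t, ‖covWalkSum U₀ Y (walk (walkEnd x (List.replicate (a + 1) (μ, true) ++ List.replicate s (ν, true)))
              [((ν, true) : Letter P.d), (μ, false), (ν, false), (μ, true)])‖) + (t : ℝ) * (2 * δ * ((t : ℝ) + (r + 1 : ℕ) + R.length + 2) * M)) :=
          add_le_add hswap ih
      _ ≤ _ := by
          push_cast
          have h1 : 0 ≤ 2 * δ * M := by positivity
          nlinarith [h1]

/-! ## §5 ★★★ The rectangle: `‖Y_{U₀}(∂R_{a×b}(x))‖ ≤ Σ_{q ∈ R} ‖Y_{U₀}(∂q)‖ + a·b·2δ·(a + 2b + 2)·M` -/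

/-- ★★★ **LINEARISED LATTICE STOKES FOR RECTANGLES (INEQUALITY FORM)**: for the boundary word `μ^a ν^b μ̄^a ν̄^b` of the `a × b` rectangle at `x`, at a background whose plaquette variables are
within `δ` of `1`, and a bond field with `‖Y b‖ ≤ M`:
`‖Y_{U₀}(walk x (μ^a ν^b μ̄^a ν̄^b))‖ ≤ Σ_{s<a} Σ_{t<b} ‖Y_{U₀}(walk y_{s,t} [ν⁺, μ̄, ν̄, μ⁺])‖ + a·b·2δ·(a + 2b + 2)·M`, `y_{s,t} = walkEnd x (μ^{s+1} ν^t) = x + (s+1)e_μ + t·e_ν` — each plaquette of the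
rectangle exactly once (as the linearised plaquette word based at its lower-right corner), plus the commutator-defect budget. [cite: Balaban1985Averaging, (19)-(20) p.21, Prop. 1 (51) p.26, (58) p.27] -/
theorem norm_covWalkSum_rect_le {δ M : ℝ} (hδ : 0 ≤ δ) (hU : PlaqSmall δ U₀) (hY : ∀ b, ‖Y b‖ ≤ M) (x : Site P j) (μ ν : Fin P.d) (b : ℕ) :
    ∀ a : ℕ, ‖covWalkSum U₀ Y (walk x (List.replicate a (μ, true) ++ List.replicate b (ν, true) ++ List.replicate a (μ, false) ++ List.replicate b (ν, false)))‖ ≤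
      (∑ s ∈ Finset.range a, ∑ t ∈ Finset.range b,
          ‖covWalkSum U₀ Y (walk (walkEnd x (List.replicate (s + 1) (μ, true) ++ List.replicate t (ν, true))) [((ν, true) : Letter P.d), (μ, false), (ν, false), (μ, true)])‖) +
        (a : ℝ) * ((b : ℝ) * (2 * δ * ((a : ℝ) + 2 * b + 2) * M))
  | 0 => by
    have h0 := covWalkSum_walk_replicate_backtrack U₀ Y x ((ν, true) : Letter P.d) b
    have hflip : Letter.flip ((ν, true) : Letter P.d) = (ν, false) := rfl
    rw [hflip] at h0
    simp [h0]
  | a + 1 => by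
    have hM0 : 0 ≤ M := (norm_nonneg _).trans (hY ⟨x, μ⟩)
    have ih := norm_covWalkSum_rect_le hδ hU hY x μ ν b a
    -- peel the last column: `t = b`, `r = 0`, tail `R = μ̄^a ν̄^b`
    have hpeel := norm_covWalkSum_colPeel_le U₀ Y hδ hU hY x μ ν a (List.replicate a (μ, false) ++ List.replicate b (ν, false)) b 0
    simp only [List.replicate_zero, List.nil_append, Nat.cast_zero, add_zero] at hpeel
    have e₁ : List.replicate (a + 1) ((μ, true) : Letter P.d) ++ List.replicate b (ν, true) ++ (μ, false) :: (List.replicate a (μ, false) ++ List.replicate b (ν, false)) =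
        List.replicate (a + 1) (μ, true) ++ List.replicate b (ν, true) ++ List.replicate (a + 1) (μ, false) ++ List.replicate b (ν, false) := by
      simp [List.replicate_succ, List.append_assoc]
    have e₂ : covWalkSum U₀ Y (walk x (List.replicate (a + 1) ((μ, true) : Letter P.d) ++ (μ, false) :: (List.replicate b (ν, true) ++ (List.replicate a (μ, false) ++ List.replicate b (ν, false))))) =
        covWalkSum U₀ Y (walk x (List.replicate a (μ, true) ++ List.replicate b (ν, true) ++ List.replicate a (μ, false) ++ List.replicate b (ν, false))) := by
      have h := covWalkSum_walk_backtrack U₀ Y x (List.replicate a (μ, true)) (List.replicate b (ν, true) ++ (List.replicate a (μ, false) ++ List.replicate b (ν, false))) (μ, true)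
      have hflip : Letter.flip ((μ, true) : Letter P.d) = (μ, false) := rfl
      have ha : List.replicate (a + 1) ((μ, true) : Letter P.d) = List.replicate a (μ, true) ++ [(μ, true)] := List.replicate_succ'
      rw [hflip] at h
      rw [ha, List.append_assoc, List.singleton_append, h]
      simp only [List.append_assoc]
    rw [e₁, e₂] at hpeel
    have hlen : ((List.replicate a ((μ, false) : Letter P.d) ++ List.replicate b (ν, false)).length : ℝ) = a + b := by
      rw [List.length_append, List.length_replicate, List.length_replicate]; push_cast; ring
    rw [hlen] at hpeel
    rw [Finset.sum_range_succ]
    calc _ ≤ ‖covWalkSum U₀ Y (walk x (List.replicate (a + 1) (μ, true) ++ List.replicate b (ν, true) ++ List.replicate (a + 1) (μ, false) ++ List.replicate b (ν, false))) -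
            covWalkSum U₀ Y (walk x (List.replicate a (μ, true) ++ List.replicate b (ν, true) ++ List.replicate a (μ, false) ++ List.replicate b (ν, false)))‖ +
          ‖covWalkSum U₀ Y (walk x (List.replicate a (μ, true) ++ List.replicate b (ν, true) ++ List.replicate a (μ, false) ++ List.replicate b (ν, false)))‖ := norm_le_norm_sub_add _ _
      _ ≤ ((∑ s ∈ Finset.range b, ‖covWalkSum U₀ Y (walk (walkEnd x (List.replicate (a + 1) (μ, true) ++ List.replicate s (ν, true)))
              [((ν, true) : Letter P.d), (μ, false), (ν, false), (μ, true)])‖) + (b : ℝ) * (2 * δ * ((b : ℝ) + (a + b) + 2) * M)) +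
          ((∑ s ∈ Finset.range a, ∑ t ∈ Finset.range b,
              ‖covWalkSum U₀ Y (walk (walkEnd x (List.replicate (s + 1) (μ, true) ++ List.replicate t (ν, true))) [((ν, true) : Letter P.d), (μ, false), (ν, false), (μ, true)])‖) +
            (a : ℝ) * ((b : ℝ) * (2 * δ * ((a : ℝ) + 2 * b + 2) * M))) := add_le_add hpeel ih
      _ ≤ _ := by
          push_cast
          have h1 : 0 ≤ 2 * δ * M := by positivity
          have hb0 : (0 : ℝ) ≤ b := Nat.cast_nonneg b
          have ha0 : (0 : ℝ) ≤ a := Nat.cast_nonneg a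
          nlinarith [mul_nonneg hb0 h1, mul_nonneg (mul_nonneg ha0 hb0) h1]

end Bounds

end Summit.QuantumFields.YangMills.Theorems.FluctuationComparisonRegPrIntLS2BetaCovWalkSumStokes

end
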